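import Summits.Ventures.Crystal3D.Theorems.StickyWulffConstantNoReconstructionGainPredSlotBudgetRaisedThreeCount
import Summits.Ventures.Crystal3D.Theorems.StickyWulffConstantNoReconstructionGainPredSlotBudgetRaisedThreeZones
import HarnessLib

/-!
# Raised up bond, three contacts: the budget in cubic coordinates

HONEST FRAMING. Part of the venture `Summits/Ventures/Crystal3D` (cell `crystal3d-full`), helper
`--supports` the crux `NoReconstructionGain` (stmt-Ventures-19144, route
`route-Ventures-StickyWulffConstant`), line `adhesion` (wulff-p1 g15).  The coordinate form of the
last sub-case of B1b₃ (`predSlotBudget_of_upBond_raised_three`, memo RAISED-g14.md §4, sub-case (iii)):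
in region R (`√(2/3) ≤ −a+b+c`, `b < a`, `0 ≤ a+b`), three contacts of depth `≥ T > a − b`, pairwise
`≤ 1`, one of which blocks the down bond `−W₃` (`x₁ − y₁ > 1`) and none of which blocks `W₃`
(`yᵢ − xᵢ ≤ 1`), earn at least THREE of the five credits `B₁, B₂, B₃, W₁, W₂` (`raisedBudget_three`).
Case analysis: `B₂` always (submerged, or `b2_blocked_of_negW3`); then `{W₁, B₃}` meet
(`noConf_B2W2`), `W₁` alone is impossible (`noConf_B2W1`), `B₃` alone is impossible by H1B
(`noThree_regimeI` for `(b+c)² ≥ 2`, `noThree_regimeII` for `(b+c)² < 2`).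

WHAT THIS IS NOT: the frame wrapper `predSlotBudget_of_upBond_raised_three`; rung F-C1 not moved.
-/

namespace Summit.Ventures.Crystal3D.Theorems

/-- **H1B.**  In region R, three contacts of depth `≥ T > b + c`, pairwise `≤ 1`, cannot all avoid the
caps of `W₁ = (0,1,1)`, `W₂ = (−1,0,1)` and `B₁ = (1,1,0)` (regime I `∪` regime II). -/
theorem noThree_H1B {a b c T x₁ y₁ z₁ x₂ y₂ z₂ x₃ y₃ z₃ : ℝ} (hn : a ^ 2 + b ^ 2 + c ^ 2 = 2)
    (hs : Real.sqrt (2 / 3) ≤ -a + b + c) (hba : b < a) (hab : 0 ≤ a + b)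
    (hu₁ : x₁ ^ 2 + y₁ ^ 2 + z₁ ^ 2 = 2) (hu₂ : x₂ ^ 2 + y₂ ^ 2 + z₂ ^ 2 = 2) (hu₃ : x₃ ^ 2 + y₃ ^ 2 + z₃ ^ 2 = 2)
    (hd₁ : T ≤ a * x₁ + b * y₁ + c * z₁) (hd₂ : T ≤ a * x₂ + b * y₂ + c * z₂) (hd₃ : T ≤ a * x₃ + b * y₃ + c * z₃)
    (hT : b + c < T)
    (h12 : x₁ * x₂ + y₁ * y₂ + z₁ * z₂ ≤ 1) (h13 : x₁ * x₃ + y₁ * y₃ + z₁ * z₃ ≤ 1)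
    (h23 : x₂ * x₃ + y₂ * y₃ + z₂ * z₃ ≤ 1)
    (q₁ : y₁ + z₁ ≤ 1) (q₂ : y₂ + z₂ ≤ 1) (q₃ : y₃ + z₃ ≤ 1)
    (m₁ : z₁ - x₁ ≤ 1) (m₂ : z₂ - x₂ ≤ 1) (m₃ : z₃ - x₃ ≤ 1)
    (b₁ : x₁ + y₁ ≤ 1) (b₂ : x₂ + y₂ ≤ 1) (b₃ : x₃ + y₃ ≤ 1) : False := by
  obtain ⟨ha, hab', -, -, hs0c, hac⟩ := regionR_bounds hn hs hba.le hab
  have hpos : 0 < Real.sqrt (2 / 3) := Real.sqrt_pos.2 (by norm_num)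
  have hT0 : 0 < b + c := by linarith
  rcases le_or_gt 2 ((b + c) ^ 2) with hsq | hII
  · exact noThree_regimeI hn hu₁ hd₁ hd₂ hd₃ h12 h13 h23 hT hT0 hsq q₁ q₂ q₃
  · exact noThree_regimeII hn hs hba hab hII hu₁ hu₂ hu₃ hd₁ hd₂ hd₃ hT h12 h13 h23 q₁ q₂ q₃ m₁ m₂ m₃ b₁ b₂ b₃

/-- **The budget for three contacts, sub-case (iii).**  Region R with `b < a`, three contacts of depth
`≥ T > a − b`, pairwise `≤ 1`, the first blocking the down bond `−W₃` (`x₁ − y₁ > 1`), none blocking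
`W₃` (`yᵢ − xᵢ ≤ 1`): at least three of the credits `B₁, B₂, B₃, W₁, W₂` are earned (abstract credit
propositions fed as in `raisedBudget_two`; `B₁` is fed by blocking, or by submersion when `a + b > 0`). -/
theorem raisedBudget_three {a b c T x₁ y₁ z₁ x₂ y₂ z₂ x₃ y₃ z₃ : ℝ} (hn : a ^ 2 + b ^ 2 + c ^ 2 = 2)
    (hs : Real.sqrt (2 / 3) ≤ -a + b + c) (hba : b < a) (hab : 0 ≤ a + b)
    (hu₁ : x₁ ^ 2 + y₁ ^ 2 + z₁ ^ 2 = 2) (hd₁ : T ≤ a * x₁ + b * y₁ + c * z₁)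
    (hu₂ : x₂ ^ 2 + y₂ ^ 2 + z₂ ^ 2 = 2) (hd₂ : T ≤ a * x₂ + b * y₂ + c * z₂)
    (hu₃ : x₃ ^ 2 + y₃ ^ 2 + z₃ ^ 2 = 2) (hd₃ : T ≤ a * x₃ + b * y₃ + c * z₃)
    (h12 : x₁ * x₂ + y₁ * y₂ + z₁ * z₂ ≤ 1) (h13 : x₁ * x₃ + y₁ * y₃ + z₁ * z₃ ≤ 1)
    (h23 : x₂ * x₃ + y₂ * y₃ + z₂ * z₃ ≤ 1)
    (hT : a - b < T) (hx : 1 < x₁ - y₁)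
    (w₁ : y₁ - x₁ ≤ 1) (w₂ : y₂ - x₂ ≤ 1) (w₃ : y₃ - x₃ ≤ 1)
    (PB1 PB2 PB3 PW1 PW2 PW3 : Prop) [Decidable PB1] [Decidable PB2] [Decidable PB3] [Decidable PW1]
    [Decidable PW2] [Decidable PW3]
    (hB1 : ((1 < x₁ + y₁ ∨ 1 < x₂ + y₂ ∨ 1 < x₃ + y₃) ∨ (0 < a + b ∧ T ≤ a + b)) → PB1)
    (hB2 : 0 < a + c → (1 < x₁ + z₁ ∨ 1 < x₂ + z₂ ∨ 1 < x₃ + z₃ ∨ T ≤ a + c) → PB2)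
    (hB3 : b < c → (1 < z₁ - y₁ ∨ 1 < z₂ - y₂ ∨ 1 < z₃ - y₃ ∨ T ≤ c - b) → PB3)
    (hW1 : (1 < y₁ + z₁ ∨ 1 < y₂ + z₂ ∨ 1 < y₃ + z₃ ∨ T ≤ b + c) → PW1)
    (hW2 : (1 < z₁ - x₁ ∨ 1 < z₂ - x₂ ∨ 1 < z₃ - x₃ ∨ T ≤ c - a) → PW2) :
    (3 : ℝ) ≤ (if PB1 then (1 : ℝ) else 0) + (if PB2 then (1 : ℝ) else 0) + (if PB3 then (1 : ℝ) else 0) +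
      (if PW1 then (1 : ℝ) else 0) + (if PW2 then (1 : ℝ) else 0) + (if PW3 then (1 : ℝ) else 0) := by
  obtain ⟨ha, hab', -, -, hs0c, hac⟩ := regionR_bounds hn hs hba.le hab
  have hpos : 0 < Real.sqrt (2 / 3) := Real.sqrt_pos.2 (by norm_num)
  have hac0 : 0 < a + c := by linarith
  have hbc : b < c := by linarith
  -- nonnegativity of all six credits
  have n1 : (0 : ℝ) ≤ (if PB1 then (1 : ℝ) else 0) := by split_ifs <;> norm_num
  have n2 : (0 : ℝ) ≤ (if PB2 then (1 : ℝ) else 0) := by split_ifs <;> norm_num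
  have n3 : (0 : ℝ) ≤ (if PB3 then (1 : ℝ) else 0) := by split_ifs <;> norm_num
  have n4 : (0 : ℝ) ≤ (if PW1 then (1 : ℝ) else 0) := by split_ifs <;> norm_num
  have n5 : (0 : ℝ) ≤ (if PW2 then (1 : ℝ) else 0) := by split_ifs <;> norm_num
  have n6 : (0 : ℝ) ≤ (if PW3 then (1 : ℝ) else 0) := by split_ifs <;> norm_num
  -- `B₂` is always credited
  have pB2 : PB2 := by
    refine hB2 hac0 ?_
    rcases le_or_gt T (a + c) with h | h
    · exact Or.inr (Or.inr (Or.inr h))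
    · exact Or.inl (b2_blocked_of_negW3 hn hs hba.le hab hu₁ hd₁ h hx)
  have e2 : (if PB2 then (1 : ℝ) else 0) = 1 := if_pos pB2
  -- the four remaining credit conditions
  by_cases cW1 : 1 < y₁ + z₁ ∨ 1 < y₂ + z₂ ∨ 1 < y₃ + z₃ ∨ T ≤ b + c
  · have e4 : (if PW1 then (1 : ℝ) else 0) = 1 := if_pos (hW1 cW1)
    by_cases cB3 : 1 < z₁ - y₁ ∨ 1 < z₂ - y₂ ∨ 1 < z₃ - y₃ ∨ T ≤ c - b
    · have e3 : (if PB3 then (1 : ℝ) else 0) = 1 := if_pos (hB3 hbc cB3)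
      linarith only [n1, e2, e3, e4, n5, n6]
    by_cases cW2 : 1 < z₁ - x₁ ∨ 1 < z₂ - x₂ ∨ 1 < z₃ - x₃ ∨ T ≤ c - a
    · have e5 : (if PW2 then (1 : ℝ) else 0) = 1 := if_pos (hW2 cW2)
      linarith only [n1, e2, n3, e4, e5, n6]
    by_cases cB1 : (1 < x₁ + y₁ ∨ 1 < x₂ + y₂ ∨ 1 < x₃ + y₃) ∨ (0 < a + b ∧ T ≤ a + b)
    · have e1 : (if PB1 then (1 : ℝ) else 0) = 1 := if_pos (hB1 cB1)
      linarith only [e1, e2, n3, e4, n5, n6]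
    -- `W₁` alone: impossible
    exfalso
    push Not at cB3 cW2 cB1
    obtain ⟨⟨hb₁, hb₂, hb₃⟩, hTab⟩ := cB1
    have hT1 : a + b < T := by
      rcases lt_or_eq_of_le hab with h | h
      · exact hTab h
      · linarith only [h, hT, ha]
    exact noConf_B2W1 hn hs hba.le hab hu₁ hd₁ hu₂ hd₂ hu₃ hd₃ h12 h13 h23 hT1 cB3.2.2.2 hb₁ hb₂ hb₃
      cB3.1 cB3.2.1 cB3.2.2.1 cW2.1 cW2.2.1 cW2.2.2.1 w₁ w₂ w₃
  · push Not at cW1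
    obtain ⟨q₁, q₂, q₃, hTm⟩ := cW1
    by_cases cB3 : 1 < z₁ - y₁ ∨ 1 < z₂ - y₂ ∨ 1 < z₃ - y₃ ∨ T ≤ c - b
    · have e3 : (if PB3 then (1 : ℝ) else 0) = 1 := if_pos (hB3 hbc cB3)
      by_cases cW2 : 1 < z₁ - x₁ ∨ 1 < z₂ - x₂ ∨ 1 < z₃ - x₃ ∨ T ≤ c - a
      · have e5 : (if PW2 then (1 : ℝ) else 0) = 1 := if_pos (hW2 cW2)
        linarith only [n1, e2, e3, n4, e5, n6]
      by_cases cB1 : (1 < x₁ + y₁ ∨ 1 < x₂ + y₂ ∨ 1 < x₃ + y₃) ∨ (0 < a + b ∧ T ≤ a + b)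
      · have e1 : (if PB1 then (1 : ℝ) else 0) = 1 := if_pos (hB1 cB1)
        linarith only [e1, e2, e3, n4, n5, n6]
      -- `B₃` alone: impossible by H1B
      exfalso
      push Not at cW2 cB1
      obtain ⟨⟨hb₁, hb₂, hb₃⟩, -⟩ := cB1
      exact noThree_H1B hn hs hba hab hu₁ hu₂ hu₃ hd₁ hd₂ hd₃ hTm h12 h13 h23 q₁ q₂ q₃
        cW2.1 cW2.2.1 cW2.2.2.1 hb₁ hb₂ hb₃
    · -- neither `W₁` nor `B₃`: impossible
      exfalso
      push Not at cB3
      exact noConf_B2W2 hn hs hba.le hab hu₁ hd₁ hu₂ hd₂ hu₃ hd₃ h12 h13 h23 cB3.2.2.2 hTm q₁ q₂ q₃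
        cB3.1 cB3.2.1 cB3.2.2.1

end Summit.Ventures.Crystal3D.Theorems
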